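import Summits.FinalStateConjecture.FinalStateConjecture.Theorems.WindowedShellChannels.Negative.LaggedApertures

/-!
# `WindowedShellChannels` (crux stmt-FinalStateConjecture-14085, route `PhotonSphereChannels`),
# negative side — the travelling packet: a shell-supported Regge–Wheeler solution whose LAGGED
# forward exterior energy is arbitrarily small at one finite time

`travelling_packet` (everything proved, no definitions): on Schwarzschild of mass `1` (tortoise
centre `xc = 0`, `s = ℓ = 0`) and for every lag `h ≥ 0` and `ε > 0`, the global `C²` solution with
Cauchy data `(F, −F′)`, `F = B(· − x₀)` a `C²` bump parked DEEP on the horizon side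
(`x₀ = h + 1 − 2u`, `u = u(h, ε)` large), has data vanishing on the closed shell `{|x| ≤ 1}` (indeed
off a bounded interval), `E_total(0) ≥ E₁ := ∫ F′² = ∫ B′² > 0`, and at time `T = u` (with `1 − h + T ≥ 0`) lagged exterior
energy `E[ψ; {1 − h + T < |x|}](T) ≤ ε E₁`.  Mechanism: up to time `u` the solution stays within
energy `(e − 1) u² · e^{h+5−u}/64 · ∫B²` of the free right-mover `F(x − t)` (energy inequality
`Blindness.energy_le_of_forcing` for the error field, whose forcing `−V F(x − t)` lives where
`V ≤ e^{(h+5−u)/2}/8`, `linePotential_zero_zero_le`), and at time `u` the free packet sits inside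
the lagged ball `{|x| ≤ 1 − h + u}`, where it contributes nothing to the exterior energy; finally
`u² e^{−u} ≤ 6/u` makes the bound `≤ ε E₁`.  Used by `FalseWithoutTwoSidedness.lean`.
-/

noncomputable section

set_option linter.dupNamespace false

namespace Summit.FinalStateConjecture.FinalStateConjecture.Theorems.WindowedShellChannels.Negative

open Literature.Geometry.Lorentzian Literature.Geometry.Lorentzian.ReggeWheeler
open Summit.FinalStateConjecture.FinalStateConjecture.Theorems.Blindness
open Summit.FinalStateConjecture.FinalStateConjecture.Theorems.FrozenPacket
open Summit.FinalStateConjecture.FinalStateConjecture.Theorems.CauchyWave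
open MeasureTheory Filter Set Function
open scoped ENNReal Topology

/-! ### The travelling packet -/

/-- **The travelling packet** (mass `1`, tortoise centre `0`, `s = ℓ = 0`).  For every lag `h ≥ 0`
and every `ε > 0` there is a global `C²` Regge–Wheeler solution `ψ` whose Cauchy data vanish on
the closed shell `{|x| ≤ 1}`, with `E_total(0) ≥ E₁ > 0` (`E₁ = ∫ F′²`), and a time `T ≥ 0` with
`(1 − h) + T ≥ 0` at which the LAGGED exterior energy `E[ψ; {1 − h + T < |x|}](T) ≤ ε E₁`: the
packet `F(x − t)` released deep on the horizon side has entered the lagged ball, and the true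
solution differs from it by `≤ ε E₁` in energy. -/
theorem travelling_packet {r : ℝ → ℝ} (hr : IsTortoiseRadius 1 r 0) {h : ℝ} (hh : 0 ≤ h)
    {ε : ℝ} (hε : 0 < ε) :
    ∃ ψ : ℝ → ℝ → ℝ, IsRWSolution 1 0 0 r ψ ∧ CauchyDataSupportedOn ψ {x : ℝ | 1 < |x - 0|} ∧
      (∃ a b : ℝ, a ≤ b ∧ CauchyDataSupportedOn ψ (Ioo a b)) ∧
      ∃ E₁ : ℝ, 0 < E₁ ∧ ENNReal.ofReal E₁ ≤ totalEnergy (linePotential 1 0 0 r) ψ 0 ∧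
      ∃ T : ℝ, 0 ≤ T ∧ 0 ≤ (1 - h) + T ∧
        exteriorEnergy (linePotential 1 0 0 r) 0 (1 - h) ψ T ≤ ENNReal.ofReal (ε * E₁) := by
  set V := linePotential 1 0 0 r with hVdef
  have hV1 : ContDiff ℝ 1 V := contDiff_one_linePotential hr 0 0
  have hVb := abs_linePotential_le hr (le_refl 0)
  have hVnn : ∀ x, 0 ≤ V x := fun x => linePotential_nonneg zero_le_one (le_refl 0) hr.two_mul_lt x
  have he1 : 0 < Real.exp 1 - 1 := by linarith [Real.add_one_le_exp (1 : ℝ)]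
  -- the profile and its two integrals
  obtain ⟨B, hB, hB0, hI₁⟩ := exists_bump
  set I₀ : ℝ := ∫ y, B y ^ 2 with hI₀
  set I₁ : ℝ := ∫ y, deriv B y ^ 2 with hI₁def
  have hI₀nn : 0 ≤ I₀ := integral_nonneg fun y => sq_nonneg _
  have hεI : 0 < ε * I₁ := mul_pos hε hI₁
  -- the scale `u`, the parking position `x₀ = h + 1 − 2u`
  set C : ℝ := 6 * (Real.exp 1 - 1) * Real.exp (h + 5) * I₀ / (64 * (ε * I₁)) with hC
  have hC0 : 0 ≤ C := by rw [hC]; positivity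
  set u : ℝ := max (h + 3) C + 1 with hu
  have huC : C < u := by rw [hu]; linarith [le_max_right (h + 3) C]
  have huh : h + 3 < u := by rw [hu]; linarith [le_max_left (h + 3) C]
  have hu0 : 0 < u := by linarith
  set x₀ : ℝ := h + 1 - 2 * u with hx₀
  -- the datum `F = B(· − x₀)`, supported in `[x₀, x₀ + 3]`
  set F : ℝ → ℝ := fun x => B (x - x₀) with hF
  have hFc : ContDiff ℝ 2 F := hB.comp (contDiff_id.sub contDiff_const)
  have hF0 : ∀ x, x ∉ Icc x₀ (x₀ + 3) → F x = 0 := by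
    intro x hx
    apply hB0
    intro hm
    exact hx ⟨by linarith [hm.1], by linarith [hm.2]⟩
  have hF0' : ∀ x, (x < x₀ ∨ x₀ + 3 < x) → F x = 0 := by
    intro x hx
    apply hF0
    intro hm
    rcases hx with hx | hx
    · linarith [hm.1]
    · linarith [hm.2]
  have hdF : ∀ x, deriv F x = deriv B (x - x₀) := fun x => by
    rw [hF]
    exact deriv_comp_sub_const (f := B) (a := x₀) (x := x)
  have hdF0 : ∀ x, (x < x₀ ∨ x₀ + 3 < x) → deriv F x = 0 := fun x hx => deriv_eq_zero_off hF0 hx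
  have hdFc : ContDiff ℝ 1 (deriv F) := contDiff_one_deriv_of_two hFc
  have hFd : ∀ y, HasDerivAt F (deriv F y) y := fun y =>
    ((hFc.differentiable (by norm_num)) y).hasDerivAt
  -- the global solution with data `(F, −F′)`
  obtain ⟨ψ, hψ2, hsol, hψ0, hψ1, hsupp⟩ := exists_solution (A := F) (B := fun x => -deriv F x)
    hV1 hVb hFc hF0 hdFc.neg (fun x hx => by
      have hx' : x < x₀ ∨ x₀ + 3 < x := by
        by_contra hcon
        push Not at hcon
        exact hx ⟨hcon.1, hcon.2⟩
      simp [hdF0 x hx'])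
  -- the free right-mover `ψₐ(t, x) = F(x − t)`
  set ψa : ℝ → ℝ → ℝ := fun t x => F (x - t) with hψa
  have haC2 : ContDiff ℝ 2 (uncurry ψa) := hFc.comp (contDiff_snd.sub contDiff_fst)
  have hat : ∀ t x, HasDerivAt (fun τ => ψa τ x) (-deriv F (x - t)) t := by
    intro t x
    have hlin : HasDerivAt (fun τ : ℝ => x - τ) (-1) t := by
      simpa using (hasDerivAt_id t).const_sub x
    have h1 := (hFd (x - t)).comp t hlin
    exact (h1.congr_of_eventuallyEq (Eventually.of_forall fun τ => rfl)).congr_deriv (by ring)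
  have hax : ∀ t x, HasDerivAt (ψa t) (deriv F (x - t)) x := by
    intro t x
    have hlin : HasDerivAt (fun y : ℝ => y - t) 1 x := (hasDerivAt_id x).sub_const t
    have h1 := (hFd (x - t)).comp x hlin
    exact (h1.congr_of_eventuallyEq (Eventually.of_forall fun y => rfl)).congr_deriv (by ring)
  have hares : ∀ t x, iteratedDeriv 2 (fun τ => ψa τ x) t - iteratedDeriv 2 (ψa t) x
      + V x * ψa t x = V x * F (x - t) := by
    intro t x
    have e1 : iteratedDeriv 2 (fun τ => ψa τ x) t = iteratedDeriv 2 F (x - t) := by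
      show iteratedDeriv 2 (fun τ => F (x - τ)) t = _
      rw [iteratedDeriv_comp_const_sub]
      norm_num
    have e2 : iteratedDeriv 2 (ψa t) x = iteratedDeriv 2 F (x - t) := by
      show iteratedDeriv 2 (fun y => F (y - t)) x = _
      rw [iteratedDeriv_comp_sub_const]
    rw [e1, e2]
    simp [hψa]
  have hasupp : ∀ t x, (x < x₀ - |t| ∨ x₀ + 3 + |t| < x) → ψa t x = 0 := by
    intro t x hx
    apply hF0'
    rcases hx with hx | hx
    · left; linarith [neg_le_abs t]
    · right; linarith [le_abs_self t]
  -- the error field `φ = ψ − ψₐ`: zero data, forcing `−V F(x − t)`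
  set φ : ℝ → ℝ → ℝ := fun t x => ψ t x - ψa t x with hφ
  have hφ2 : ContDiff ℝ 2 (uncurry φ) := hψ2.sub haC2
  have hφsupp : ∀ t x, (x < x₀ - |t| ∨ x₀ + 3 + |t| < x) → φ t x = 0 := by
    intro t x hx
    simp [hφ, hsupp t x hx, hasupp t x hx]
  have hφ0 : ∀ x, φ 0 x = 0 := fun x => by simp [hφ, hψa, hψ0 x]
  have hψline : ∀ x, HasDerivAt (fun τ => ψ τ x) (-deriv F x) 0 := by
    intro x
    have h1 := (hasDerivAt_time (hψ2.of_le (by norm_num)) 0 x).differentiableAt.hasDerivAt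
    rwa [hψ1 x] at h1
  have hφ1 : ∀ x, deriv (fun τ => φ τ x) 0 = 0 := by
    intro x
    have h1 := (hψline x).sub (hat 0 x)
    have h' : HasDerivAt (fun τ => φ τ x) (-deriv F x - -deriv F (x - 0)) 0 :=
      h1.congr_of_eventuallyEq (Eventually.of_forall fun τ => rfl)
    rw [h'.deriv]
    simp
  have hφres : ∀ t x, iteratedDeriv 2 (fun τ => φ τ x) t - iteratedDeriv 2 (φ t) x + V x * φ t x
      = -(V x * F (x - t)) := by
    intro t x
    obtain ⟨hψt, hψx⟩ := contDiff_two_lines hψ2 t x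
    obtain ⟨hat2, hax2⟩ := contDiff_two_lines haC2 t x
    have e1 : iteratedDeriv 2 (fun τ => φ τ x) t
        = iteratedDeriv 2 (fun τ => ψ τ x) t - iteratedDeriv 2 (fun τ => ψa τ x) t :=
      iteratedDeriv_two_sub hψt hat2 t
    have e2 : iteratedDeriv 2 (φ t) x = iteratedDeriv 2 (ψ t) x - iteratedDeriv 2 (ψa t) x :=
      iteratedDeriv_two_sub hψx hax2 x
    rw [e1, e2]
    have h1 := hsol t x
    have h2 := hares t x
    simp only [hφ]
    linear_combination h1 - h2
  -- the potential on the region swept by the packet up to time `u`: `V² ≤ η₂ = e^{h+5−u}/64`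
  set η2 : ℝ := Real.exp (h + 5 - u) / 64 with hη2
  have hη2nn : 0 ≤ η2 := by rw [hη2]; positivity
  have hV2 : ∀ x, x ≤ x₀ + 3 + u → V x ^ 2 ≤ η2 := by
    intro x hx
    have hVx : V x ≤ Real.exp ((x + 1) / 2) / 8 := linePotential_zero_zero_le hr x
    have hmono : Real.exp ((x + 1) / 2) ≤ Real.exp ((x₀ + 3 + u + 1) / 2) :=
      Real.exp_le_exp.2 (by linarith)
    have hb : V x ≤ Real.exp ((x₀ + 3 + u + 1) / 2) / 8 := by linarith
    have hsum : (x₀ + 3 + u + 1) / 2 + (x₀ + 3 + u + 1) / 2 = h + 5 - u := by rw [hx₀]; ring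
    calc V x ^ 2 ≤ (Real.exp ((x₀ + 3 + u + 1) / 2) / 8) ^ 2 := pow_le_pow_left₀ (hVnn x) hb 2
      _ = η2 := by rw [hη2, div_pow, sq, ← Real.exp_add, hsum]; norm_num
  -- the forcing is small in `L²` up to time `u`
  have hN2 : ∀ t ∈ Icc 0 u, ∫ x, (iteratedDeriv 2 (fun τ => φ τ x) t - iteratedDeriv 2 (φ t) x
      + V x * φ t x) ^ 2 ≤ η2 * I₀ := by
    intro t ht
    have heq : (fun x => (iteratedDeriv 2 (fun τ => φ τ x) t - iteratedDeriv 2 (φ t) x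
        + V x * φ t x) ^ 2) = fun x => V x ^ 2 * F (x - t) ^ 2 := by
      funext x; rw [hφres t x]; ring
    rw [heq]
    have hpt : ∀ x, V x ^ 2 * F (x - t) ^ 2 ≤ η2 * F (x - t) ^ 2 := by
      intro x
      rcases le_or_gt x (x₀ + 3 + u) with hx | hx
      · exact mul_le_mul_of_nonneg_right (hV2 x hx) (sq_nonneg _)
      · have hz : F (x - t) = 0 := hF0' _ (Or.inr (by linarith [ht.2]))
        simp [hz]
    have hcont : Continuous fun x => F (x - t) ^ 2 :=
      (hFc.continuous.comp (continuous_id.sub continuous_const)).pow 2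
    have hcs : HasCompactSupport fun x => η2 * F (x - t) ^ 2 := by
      refine hasCompactSupport_of_exterior (a := x₀ + t) (b := x₀ + 3 + t) fun x hx => ?_
      have hz : F (x - t) = 0 := by
        apply hF0'
        rcases hx with hx | hx
        · left; linarith
        · right; linarith
      simp [hz]
    have hint : Integrable fun x => η2 * F (x - t) ^ 2 :=
      (continuous_const.mul hcont).integrable_of_hasCompactSupport hcs
    have htrans : ∫ x, F (x - t) ^ 2 = I₀ := by
      have e : ∀ x, F (x - t) = B (x - (t + x₀)) := fun x => by simp only [hF]; ring_nf
      simp_rw [e]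
      exact integral_sub_right_eq_self (fun y => B y ^ 2) (t + x₀)
    calc ∫ x, V x ^ 2 * F (x - t) ^ 2 ≤ ∫ x, η2 * F (x - t) ^ 2 :=
          integral_mono_of_nonneg (Eventually.of_forall fun x => by positivity) hint
            (Eventually.of_forall hpt)
      _ = η2 * ∫ x, F (x - t) ^ 2 := integral_const_mul _ _
      _ = η2 * I₀ := by rw [htrans]
  -- the energy inequality for the error field on `[0, u]`
  have hEφ := energy_le_of_forcing hφ2 hV1 hVnn hφsupp hφ0 hφ1 hu0 (mul_nonneg hη2nn hI₀nn) hN2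
  -- at time `u` the packet is inside the lagged ball: densities of `ψ` and `φ` agree outside
  have haT : 0 ≤ (1 - h) + u := by linarith
  have hagree : ∀ x ∈ {x : ℝ | (1 - h) + |u| < |x - 0|},
      energyDensity V ψ u x = energyDensity V φ u x := by
    intro x hx
    simp only [mem_setOf_eq, sub_zero, abs_of_pos hu0] at hx
    have hxT : x - u < x₀ ∨ x₀ + 3 < x - u := by
      rcases lt_abs.1 hx with hx | hx
      · right; linarith
      · left; linarith
    have hF1 : F (x - u) = 0 := hF0' _ hxT
    have hF2 : deriv F (x - u) = 0 := hdF0 _ hxT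
    have hψt := hasDerivAt_time (hψ2.of_le (by norm_num)) u x
    have hψx := hasDerivAt_space (hψ2.of_le (by norm_num)) u x
    have hφt : HasDerivAt (fun τ => φ τ x)
        (fderiv ℝ (uncurry ψ) (u, x) (1, 0) - -deriv F (x - u)) u :=
      (hψt.sub (hat u x)).congr_of_eventuallyEq (Eventually.of_forall fun τ => rfl)
    have hφx : HasDerivAt (φ u) (fderiv ℝ (uncurry ψ) (u, x) (0, 1) - deriv F (x - u)) x :=
      (hψx.sub (hax u x)).congr_of_eventuallyEq (Eventually.of_forall fun y => rfl)
    unfold energyDensity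
    rw [hψt.deriv, hψx.deriv, hφt.deriv, hφx.deriv, hF2]
    simp [hφ, hψa, hF1]
  have hmeas : MeasurableSet {x : ℝ | (1 - h) + |u| < |x - 0|} :=
    (isOpen_lt continuous_const (continuous_abs.comp (continuous_id.sub continuous_const))).measurableSet
  have hext : exteriorEnergy V 0 (1 - h) ψ u
      ≤ ENNReal.ofReal ((Real.exp 1 - 1) * u ^ 2 * (η2 * I₀)) := by
    unfold exteriorEnergy
    calc ∫⁻ x in {x : ℝ | (1 - h) + |u| < |x - 0|}, ENNReal.ofReal (energyDensity V ψ u x)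
        = ∫⁻ x in {x : ℝ | (1 - h) + |u| < |x - 0|}, ENNReal.ofReal (energyDensity V φ u x) :=
          setLIntegral_congr_fun hmeas (fun x hx => by rw [hagree x hx])
      _ ≤ ∫⁻ x, ENNReal.ofReal (energyDensity V φ u x) := setLIntegral_le_lintegral _ _
      _ = ENNReal.ofReal (∫ x, energyDensity V φ u x) := by
          unfold energyDensity
          rw [ofReal_integral_eq_lintegral_ofReal
            (integrable_energyDensity hV1.continuous hφ2 hφsupp u)
            (Eventually.of_forall fun x => ReggeWheeler.energyDensity_nonneg φ u (hVnn x))]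
      _ ≤ ENNReal.ofReal ((Real.exp 1 - 1) * u ^ 2 * (η2 * I₀)) :=
          ENNReal.ofReal_le_ofReal (hEφ u ⟨hu0.le, le_rfl⟩)
  -- the initial energy: `E_total(0) ≥ ∫ F′² = ∫ B′² = I₁`
  have hE : ENNReal.ofReal I₁ ≤ totalEnergy V ψ 0 := by
    unfold totalEnergy
    have hI₁F : I₁ = ∫ x, deriv F x ^ 2 := by
      simp_rw [hdF]
      exact (integral_sub_right_eq_self (fun y => deriv B y ^ 2) x₀).symm
    have hcs : HasCompactSupport fun x => deriv F x ^ 2 :=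
      hasCompactSupport_of_exterior (a := x₀) (b := x₀ + 3) fun x hx => by rw [hdF0 x hx]; ring
    have hintF : Integrable fun x => deriv F x ^ 2 :=
      (hdFc.continuous.pow 2).integrable_of_hasCompactSupport hcs
    rw [hI₁F, ofReal_integral_eq_lintegral_ofReal hintF (Eventually.of_forall fun x => sq_nonneg _)]
    refine lintegral_mono fun x => ENNReal.ofReal_le_ofReal ?_
    have hψ0' : ψ 0 = F := funext hψ0
    unfold energyDensity
    rw [hψ0']
    nlinarith [sq_nonneg (deriv (fun τ => ψ τ x) 0), mul_nonneg (hVnn x) (sq_nonneg (F x))]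
  -- the smallness of the bound: `(e − 1) u² e^{h+5−u} I₀ / 64 ≤ ε I₁`
  have hsmall : (Real.exp 1 - 1) * u ^ 2 * (η2 * I₀) ≤ ε * I₁ := by
    have hexp : u ^ 3 ≤ 6 * Real.exp u := by
      have h3 := Real.pow_div_factorial_le_exp u hu0.le 3
      have hfac : ((Nat.factorial 3 : ℕ) : ℝ) = 6 := by norm_num [Nat.factorial]
      rw [hfac, div_le_iff₀ (by norm_num : (0 : ℝ) < 6)] at h3
      linarith
    have hprod : Real.exp u * Real.exp (-u) = 1 := by rw [← Real.exp_add]; simp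
    have hsplit : Real.exp (h + 5 - u) = Real.exp (h + 5) * Real.exp (-u) := by
      rw [← Real.exp_add]; ring_nf
    have hue : u ^ 2 * Real.exp (-u) ≤ 6 / u := by
      rw [le_div_iff₀ hu0]
      have e3 : u ^ 2 * Real.exp (-u) * u = u ^ 3 * Real.exp (-u) := by ring
      rw [e3]
      calc u ^ 3 * Real.exp (-u) ≤ 6 * Real.exp u * Real.exp (-u) :=
            mul_le_mul_of_nonneg_right hexp (Real.exp_pos _).le
        _ = 6 := by rw [mul_assoc, hprod, mul_one]
    have hK : 0 ≤ (Real.exp 1 - 1) * Real.exp (h + 5) * I₀ / 64 := by positivity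
    calc (Real.exp 1 - 1) * u ^ 2 * (η2 * I₀)
        = (Real.exp 1 - 1) * Real.exp (h + 5) * I₀ / 64 * (u ^ 2 * Real.exp (-u)) := by
          rw [hη2, hsplit]; ring
      _ ≤ (Real.exp 1 - 1) * Real.exp (h + 5) * I₀ / 64 * (6 / u) :=
          mul_le_mul_of_nonneg_left hue hK
      _ = C * (ε * I₁) / u := by
          rw [hC]
          field_simp
      _ ≤ ε * I₁ := by
          rw [div_le_iff₀ hu0]
          nlinarith [huC, hεI]
  -- the Cauchy data vanish off `(x₀ − 1, x₀ + 4)`, in particular on the closed shell `{|x| ≤ 1}`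
  have hvan : ∀ x, (x < x₀ ∨ x₀ + 3 < x) → ψ 0 x = 0 ∧ deriv (fun τ => ψ τ x) 0 = 0 := by
    intro x hx'
    refine ⟨by rw [hψ0 x]; exact hF0' x hx', ?_⟩
    rw [hψ1 x, hdF0 x hx']
    simp
  have hdataI : CauchyDataSupportedOn ψ (Ioo (x₀ - 1) (x₀ + 4)) := by
    intro x hx
    apply hvan
    simp only [mem_Ioo, not_and_or, not_lt] at hx
    rcases hx with hx | hx
    · left; linarith
    · right; linarith
  -- assemble
  refine ⟨ψ, ⟨hψ2, fun z => hsol z.1 z.2⟩, ?_, ⟨x₀ - 1, x₀ + 4, by linarith, hdataI⟩, I₁, hI₁, hE,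
    u, hu0.le, haT, hext.trans (ENNReal.ofReal_le_ofReal hsmall)⟩
  intro x hx
  simp only [mem_setOf_eq, sub_zero, not_lt] at hx
  exact hvan x (Or.inr (by linarith [neg_abs_le x, abs_nonneg x]))


end Summit.FinalStateConjecture.FinalStateConjecture.Theorems.WindowedShellChannels.Negative

end
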